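import Literature.Probability.LatticeModels.FKInterfacePairing
import HarnessLib

/-!
# FK-continuity transplant, FO-06 (construction half): the EXACT one-edge conditional
# probabilities of the finite-volume random-cluster measure (Grimmett 2006, Thm. (3.1), eq. (3.3))

Cell `fk-continuity` (bschramm), row FO-06b-5; support file for the FK-continuity transplant
(`--supports stmt-CriticalPhenomena-4575`); builds on p205010 (kernel theorem, internal audit signed;
external expert review pending). No named facts, no sorries, standard axioms.

Grimmett 2006, Thm. (3.1)(a), eq. (3.3): for the random-cluster measure `φ = φ^B_{G,p,q}` of a finite
graph `G` (wired set `B`), an edge `e = ⟨u,v⟩` of `G` and a configuration `ξ`,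
`φ(e open | ω = ξ off e) = p` if `u, v` are joined by an open path of `ξ` not using `e` (through the
wired set `B` if need be), and `= p / (p + q(1-p))` otherwise. The tree so far holds only the two
INEQUALITIES this implies for `q ≥ 1` (finite energy, `RandomClusterFiniteEnergy.lean`,
`rcMeasure_real_edgeOpen_ge`); here we prove the identities themselves, in INTEGRATED form — for every
event `S` determined off `e` (`ω ∈ S ↔ ω ∪ {e} ∈ S`):

* `rcMeasure_real_inter_edgeOpen_eq_mul_of_joined` — if the endpoints of `e` are joined off `e` on
  `S`, then `φ(S ∩ {e open}) = p · φ(S)`;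
* `rcMeasure_real_inter_edgeOpen_eq_mul_of_not_joined` — if they are not joined off `e` on `S`, then
  `φ(S ∩ {e open}) = p/(p + q(1-p)) · φ(S)`;

valid for all `0 ≤ p ≤ 1`, `q > 0` and every wired set `B` ("joined" is reachability in
`openGraph (ω ∖ {e}) ⊔ wired B`, the relation counted by the tree's `clusterCount`). The engine is the
tree's weight identity `rcWeight_insert` (`w(ω ∪ e)·(1-p)·q^{[u ≁ v]} = w(ω)·p`,
`FKInterfacePairing.lean`) summed over `S` after the reindexing `ω ↦ ω ∪ {e}`
(`sum_filter_mem_eq_sum_filter_not_mem_insert`). These are the finite-volume input of the DLR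
(Gibbs) property of the infinite-volume limits, Grimmett 2006 Prop. (4.37) eq. (4.38)
(`InfiniteVolumeOneEdgeDLR.lean`).

## References

* G. Grimmett, *The Random-Cluster Model*, Springer 2006: §1.2 eq. (1.2); Thm. (3.1)(a), eq. (3.3),
  p. 38; Prop. (4.37), eq. (4.38), p. 82. [Grimmett2006]
-/

noncomputable section

open MeasureTheory Finset
open scoped ENNReal

namespace Summit.CriticalPhenomena.PercolationContinuityZ3.Theorems.FK

open Literature.Probability.Percolation Literature.Probability.LatticeModels

variable {V : Type*} [Fintype V] [DecidableEq V] (G : SimpleGraph V) [DecidableRel G.Adj]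

/-! ### Reindexing the configurations containing a fixed edge -/

/-- The configurations `η ⊆ E(G)` containing the edge `e ∈ E(G)` are exactly the `ω ∪ {e}` with
`ω ⊆ E(G)`, `e ∉ ω`. [folklore] -/
theorem image_insert_filter_not_mem_powerset {e : Sym2 V} (he : e ∈ G.edgeFinset) :
    (G.edgeFinset.powerset.filter fun ω => e ∉ ω).image (fun ω => insert e ω) =
      G.edgeFinset.powerset.filter fun η => e ∈ η := by
  ext η
  simp only [Finset.mem_image, Finset.mem_filter, Finset.mem_powerset]
  constructor
  · rintro ⟨ω, ⟨hω, -⟩, rfl⟩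
    exact ⟨Finset.insert_subset he hω, Finset.mem_insert_self e ω⟩
  · rintro ⟨hη, heη⟩
    refine ⟨η.erase e, ⟨(Finset.erase_subset e η).trans hη, Finset.notMem_erase e η⟩, ?_⟩
    exact Finset.insert_erase heη

/-- **Reindexing** `η = ω ∪ {e}`: a sum over the configurations containing `e ∈ E(G)` is the sum of
the shifted summand over the configurations avoiding `e`. [folklore] -/
theorem sum_filter_mem_eq_sum_filter_not_mem_insert {e : Sym2 V} (he : e ∈ G.edgeFinset)
    (f : Finset (Sym2 V) → ℝ) :
    ∑ η ∈ G.edgeFinset.powerset.filter (fun η => e ∈ η), f η =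
      ∑ ω ∈ G.edgeFinset.powerset.filter (fun ω => e ∉ ω), f (insert e ω) := by
  rw [← image_insert_filter_not_mem_powerset G he, Finset.sum_image]
  intro ω hω ω' hω' h
  rw [Finset.mem_coe, Finset.mem_filter] at hω hω'
  have := congrArg (fun s => Finset.erase s e) h
  simpa only [Finset.erase_insert hω.2, Finset.erase_insert hω'.2] using this

/-! ### The summed weight identity -/

/-- **Summed one-edge weight identity.** Let `e ∈ E(G)`, `0 ≤ p ≤ 1`, `q > 0`, and let `S` be an event
determined off `e` (`ω ∪ {e} ∈ S ↔ ω ∈ S`). If on `S` opening `e` multiplies the weight by the constant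
ratio `p/κ` — `w(ω ∪ {e})·κ = w(ω)·p` for every `ω ⊆ E(G)` with `e ∉ ω`, `ω ∈ S` — then
`κ · φ(S ∩ {e open}) = p · φ(S ∩ {e closed})`. [cite: Grimmett2006, Thm. (3.1)(a), eq. (3.3)] -/
theorem mul_rcMeasure_real_inter_edgeOpen_eq {p q : ℝ} (hp : p ∈ Set.Icc (0 : ℝ) 1) (hq : 0 < q)
    (B : Set V) {e : Sym2 V} (he : e ∈ G.edgeFinset) {S : Set (BondConfig V)}
    (hS : ∀ ω : BondConfig V, insert e ω ∈ S ↔ ω ∈ S) {κ : ℝ}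
    (hκ : ∀ ω : Finset (Sym2 V), ω ⊆ G.edgeFinset → e ∉ ω → (↑ω : BondConfig V) ∈ S →
      rcWeight G p q B (insert e ω) * κ = rcWeight G p q B ω * p) :
    κ * (rcMeasure G p q B).real (S ∩ {ω | e ∈ ω}) =
      p * (rcMeasure G p q B).real (S ∩ {ω | e ∉ ω}) := by
  classical
  -- restrict both sums to the configurations containing / avoiding `e`
  have h1 : (rcMeasure G p q B).real (S ∩ {ω | e ∈ ω}) =
      ∑ η ∈ G.edgeFinset.powerset.filter (fun η => e ∈ η),
        (if (↑η : BondConfig V) ∈ S then rcWeight G p q B η / rcPartitionFunction G p q B else 0) := by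
    rw [rcMeasure_real_apply G hp hq B _, Finset.sum_filter]
    refine Finset.sum_congr rfl fun ω _ => ?_
    by_cases heω : e ∈ ω <;> by_cases hωS : (↑ω : BondConfig V) ∈ S <;> simp [heω, hωS]
  have h2 : (rcMeasure G p q B).real (S ∩ {ω | e ∉ ω}) =
      ∑ ω ∈ G.edgeFinset.powerset.filter (fun ω => e ∉ ω),
        (if (↑ω : BondConfig V) ∈ S then rcWeight G p q B ω / rcPartitionFunction G p q B else 0) := by
    rw [rcMeasure_real_apply G hp hq B _, Finset.sum_filter]
    refine Finset.sum_congr rfl fun ω _ => ?_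
    by_cases heω : e ∈ ω <;> by_cases hωS : (↑ω : BondConfig V) ∈ S <;> simp [heω, hωS]
  rw [h1, h2, sum_filter_mem_eq_sum_filter_not_mem_insert G he, Finset.mul_sum, Finset.mul_sum]
  refine Finset.sum_congr rfl fun ω hω => ?_
  obtain ⟨hωE, heω⟩ := Finset.mem_filter.1 hω
  have hωE' : ω ⊆ G.edgeFinset := Finset.mem_powerset.1 hωE
  have hSiff : (↑(insert e ω) : BondConfig V) ∈ S ↔ (↑ω : BondConfig V) ∈ S := by
    rw [Finset.coe_insert]
    exact hS _
  by_cases hωS : (↑ω : BondConfig V) ∈ S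
  · rw [if_pos (hSiff.2 hωS), if_pos hωS, mul_div_assoc', mul_div_assoc', mul_comm κ, mul_comm p,
      hκ ω hωE' heω hωS]
  · rw [if_neg (fun h => hωS (hSiff.1 h)), if_neg hωS, mul_zero, mul_zero]

/-- `φ(S) = φ(S ∩ {e open}) + φ(S ∩ {e closed})` for the finite-volume measure (finite sums).
[cite: Grimmett2006, §1.2 eq. (1.2)] -/
theorem rcMeasure_real_eq_inter_edgeOpen_add {p q : ℝ} (hp : p ∈ Set.Icc (0 : ℝ) 1) (hq : 0 < q)
    (B : Set V) (e : Sym2 V) (S : Set (BondConfig V)) :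
    (rcMeasure G p q B).real S =
      (rcMeasure G p q B).real (S ∩ {ω | e ∈ ω}) + (rcMeasure G p q B).real (S ∩ {ω | e ∉ ω}) := by
  classical
  rw [rcMeasure_real_apply G hp hq B S, rcMeasure_real_apply G hp hq B (S ∩ {ω | e ∈ ω}),
    rcMeasure_real_apply G hp hq B (S ∩ {ω | e ∉ ω}), ← Finset.sum_add_distrib]
  refine Finset.sum_congr rfl fun ω _ => ?_
  by_cases heω : e ∈ ω <;> by_cases hωS : (↑ω : BondConfig V) ∈ S <;> simp [heω, hωS]

/-! ### Grimmett's (3.3): the two cases -/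

/-- **One-edge conditional probability, joined case** (Grimmett 2006, Thm. (3.1)(a), eq. (3.3), first
line): `e = ⟨u,v⟩ ∈ E(G)`, `0 ≤ p ≤ 1`, `q > 0`, any wired set `B`; if `S` is determined off `e` and, for
every `ω ∈ S`, `u` and `v` are joined in `openGraph (ω ∖ {e}) ⊔ wired B` (an open path avoiding `e`,
possibly through the wired set), then `φ^B_{G,p,q}(S ∩ {e open}) = p · φ^B_{G,p,q}(S)`.
[cite: Grimmett2006, Thm. (3.1)(a), eq. (3.3)] -/
theorem rcMeasure_real_inter_edgeOpen_eq_mul_of_joined {p q : ℝ} (hp : p ∈ Set.Icc (0 : ℝ) 1)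
    (hq : 0 < q) (B : Set V) {u v : V} (he : s(u, v) ∈ G.edgeFinset) {S : Set (BondConfig V)}
    (hS : ∀ ω : BondConfig V, insert s(u, v) ω ∈ S ↔ ω ∈ S)
    (hjoin : ∀ ω ∈ S, (openGraph (ω \ {s(u, v)}) ⊔ wired B).Reachable u v) :
    (rcMeasure G p q B).real (S ∩ {ω | s(u, v) ∈ ω}) = p * (rcMeasure G p q B).real S := by
  classical
  have hκ : ∀ ω : Finset (Sym2 V), ω ⊆ G.edgeFinset → s(u, v) ∉ ω → (↑ω : BondConfig V) ∈ S →
      rcWeight G p q B (insert s(u, v) ω) * (1 - p) = rcWeight G p q B ω * p := by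
    intro ω _ heω hωS
    have hreach : (openGraph (↑ω : BondConfig V) ⊔ wired B).Reachable u v := by
      have h := hjoin _ hωS
      have hdiff : (↑ω : BondConfig V) \ {s(u, v)} = ↑ω := by
        rw [sdiff_eq_left, Set.disjoint_singleton_right]
        exact fun h' => heω (Finset.mem_coe.1 h')
      rwa [hdiff] at h
    have h := rcWeight_insert G p q B he heω
    rwa [if_pos hreach, pow_zero, mul_one] at h
  have key := mul_rcMeasure_real_inter_edgeOpen_eq G hp hq B he hS hκ
  have hsplit := rcMeasure_real_eq_inter_edgeOpen_add G hp hq B s(u, v) S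
  -- `(1-p)·a = p·b`, `φ(S) = a + b` ⇒ `a = p·φ(S)`
  rw [hsplit]
  linear_combination key

/-- **One-edge conditional probability, separated case** (Grimmett 2006, Thm. (3.1)(a), eq. (3.3),
second line): `e = ⟨u,v⟩ ∈ E(G)`, `0 ≤ p ≤ 1`, `q > 0`, any wired set `B`; if `S` is determined off `e`
and, for every `ω ∈ S`, `u` and `v` are NOT joined in `openGraph (ω ∖ {e}) ⊔ wired B`, then
`φ^B_{G,p,q}(S ∩ {e open}) = p/(p + q(1-p)) · φ^B_{G,p,q}(S)`.
[cite: Grimmett2006, Thm. (3.1)(a), eq. (3.3)] -/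
theorem rcMeasure_real_inter_edgeOpen_eq_mul_of_not_joined {p q : ℝ} (hp : p ∈ Set.Icc (0 : ℝ) 1)
    (hq : 0 < q) (B : Set V) {u v : V} (he : s(u, v) ∈ G.edgeFinset) {S : Set (BondConfig V)}
    (hS : ∀ ω : BondConfig V, insert s(u, v) ω ∈ S ↔ ω ∈ S)
    (hsep : ∀ ω ∈ S, ¬ (openGraph (ω \ {s(u, v)}) ⊔ wired B).Reachable u v) :
    (rcMeasure G p q B).real (S ∩ {ω | s(u, v) ∈ ω}) =
      p / (p + q * (1 - p)) * (rcMeasure G p q B).real S := by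
  classical
  have hκ : ∀ ω : Finset (Sym2 V), ω ⊆ G.edgeFinset → s(u, v) ∉ ω → (↑ω : BondConfig V) ∈ S →
      rcWeight G p q B (insert s(u, v) ω) * ((1 - p) * q) = rcWeight G p q B ω * p := by
    intro ω _ heω hωS
    have hreach : ¬ (openGraph (↑ω : BondConfig V) ⊔ wired B).Reachable u v := by
      have h := hsep _ hωS
      have hdiff : (↑ω : BondConfig V) \ {s(u, v)} = ↑ω := by
        rw [sdiff_eq_left, Set.disjoint_singleton_right]
        exact fun h' => heω (Finset.mem_coe.1 h')
      rwa [hdiff] at h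
    have h := rcWeight_insert G p q B he heω
    rw [if_neg hreach, pow_one] at h
    rw [← mul_assoc]
    exact h
  have key := mul_rcMeasure_real_inter_edgeOpen_eq G hp hq B he hS hκ
  have hsplit := rcMeasure_real_eq_inter_edgeOpen_add G hp hq B s(u, v) S
  have hden : 0 < p + q * (1 - p) := by
    rcases eq_or_lt_of_le hp.2 with h1 | h1
    · rw [h1]; norm_num
    · have : 0 < q * (1 - p) := mul_pos hq (by linarith)
      linarith [hp.1]
  rw [hsplit, div_mul_eq_mul_div, eq_div_iff hden.ne']
  linear_combination key
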